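import Literature.NumberTheory.EllipticCurves.TianYuanZhang2017.CMPointRingClassDisplays
import HarnessLib

/-!
# Tian–Yuan–Zhang 2017 Prop. 3.2 ring class dictionary — proofs companion (refinements, stabiliser bookkeeping)

Theorems-only sibling (no definition, no named fact, no instance; D-0026, net debt 0) of `CMPointRingClassDisplays.lean`
(cell `bsd-print-cf2`, seat `bsd-print-cf2-ty2`): the named fact `tyz_cmPointRingClassData` REFINES `tyz_cmPointGaloisData` and
`tyz_genusPointData` (drop the ring class dictionaries, resp. the whole CM-point layer), and the elements of `Gal(ℍ′_n/H_d)` / the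
automorphisms trivial on `L_d(i)` lie in the stabiliser `galK D d = Gal(ℍ′_n/K_d)` on which the dictionaries `ρ_d` are defined.
Nothing about BSD is asserted or proved here.

References: [TianYuanZhang2017] §3.1 (p0011 L1–L13), Prop. 3.2 (p0010 L106–L113), proof of Lemma 3.21 (p0020 L50–L63), §2.1 (J725).
-/

noncomputable section

open scoped Classical

namespace Literature.NumberTheory.EllipticCurves.TianYuanZhang2017

namespace GenusPointData

variable {n : ℕ}

/-- An automorphism trivial on the genus field `L_d` lies in `Gal(ℍ′_n/K_d)` (it fixes `√−d`); in particular so does every element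
of `Gal(ℍ′_n/H_d)` under (G4) of `CMPointGaloisPrinted`. [cite: TianYuanZhang2017, §2.1 (J725 L11–L16) and §3.1 (p0011 L1–L13)] -/
theorem mem_galK_of_fixesGenusField (D : GenusPointData n) {d : ℕ} {g : D.H ≃ₐ[ℚ] D.H}
    (hg : D.FixesGenusField d g) : g ∈ D.galK d :=
  (D.mem_galK_iff d g).mpr hg.1

/-- An automorphism trivial on `L_d(i)` lies in `Gal(ℍ′_n/K_d)` whenever `1 < d` (it fixes `√−d`, `d` being a divisor of itself).
[cite: TianYuanZhang2017, proof of Lemma 3.21 (p0020 L55–L58)] -/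
theorem mem_galK_of_trivialOnL (D : GenusPointData n) {d : ℕ} (hd : 1 < d) {g : D.H ≃ₐ[ℚ] D.H}
    (hg : D.TrivialOnL d g) : g ∈ D.galK d :=
  (D.mem_galK_iff d g).mpr (hg.2 d (Nat.mem_divisors_self d (Nat.ne_zero_of_lt hd)) hd)

/-- Under (G4) of a block (`Gal(ℍ′_n/H′_d) ⊆ Gal(ℍ′_n/H_d)`, the latter trivial on the genus field), both subgroups lie in
`Gal(ℍ′_n/K_d)`. [cite: TianYuanZhang2017, §3.1 (p0011 L1–L13) and §2.1 (J725 L11–L16)] -/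
theorem le_galK_of_cmBlockSpec (D : GenusPointData n) {d : ℕ} {z : APoint D.H} {Φ : Finset (D.H ≃ₐ[ℚ] D.H)}
    {ΓH ΓH' : Subgroup (D.H ≃ₐ[ℚ] D.H)} {σ c : D.H ≃ₐ[ℚ] D.H} (h : D.CMBlockSpec d z Φ ΓH ΓH' σ c) :
    ΓH ≤ D.galK d ∧ ΓH' ≤ D.galK d :=
  ⟨fun _ hγ => D.mem_galK_of_fixesGenusField (h.2.2.2.1.2 _ hγ),
    fun _ hγ => D.mem_galK_of_fixesGenusField (h.2.2.2.1.2 _ (h.2.2.2.1.1 _ hγ))⟩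

/-- Under (G6) of a block, `σ ∈ Gal(ℍ′_n/K_d)`. [cite: TianYuanZhang2017, §3.1 (p0011 L3–L4)] -/
theorem sigma_mem_galK_of_cmBlockSpec (D : GenusPointData n) {d : ℕ} {z : APoint D.H} {Φ : Finset (D.H ≃ₐ[ℚ] D.H)}
    {ΓH ΓH' : Subgroup (D.H ≃ₐ[ℚ] D.H)} {σ c : D.H ≃ₐ[ℚ] D.H} (h : D.CMBlockSpec d z Φ ΓH ΓH' σ c) :
    σ ∈ D.galK d :=
  (D.le_galK_of_cmBlockSpec h).1 h.2.2.2.2.2.1.1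

/-- The ring class layer refines the CM-point layer (drop the dictionaries). [cite: TianYuanZhang2017, §3.1–3.2 and Prop. 3.2] -/
theorem cmPointGaloisPrinted_of_cmPointRingClassPrinted (D : GenusPointData n) (h : D.CMPointRingClassPrinted) :
    D.CMPointGaloisPrinted := by
  obtain ⟨z, Φ, ΓH, ΓH', σ, θ, c, _ρ₂, _ρ₄, hc, hd⟩ := h
  exact ⟨z, Φ, ΓH, ΓH', σ, θ, c, hc, fun d hd' => ⟨(hd d hd').1, (hd d hd').2.1, (hd d hd').2.2.1⟩⟩

end GenusPointData

/-- `tyz_cmPointRingClassData` refines `tyz_cmPointGaloisData` (drop the ring class dictionaries).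
[cite: TianYuanZhang2017, §3 and Prop. 3.2] -/
theorem tyz_cmPointGaloisData_of_cmPointRingClassData (h : tyz_cmPointRingClassData) : tyz_cmPointGaloisData := by
  intro n hn h8
  obtain ⟨D, hD, hR⟩ := h n hn h8
  exact ⟨D, hD, D.cmPointGaloisPrinted_of_cmPointRingClassPrinted hR⟩

/-- `tyz_cmPointRingClassData` refines `tyz_genusPointData`. [cite: TianYuanZhang2017, §3] -/
theorem tyz_genusPointData_of_cmPointRingClassData (h : tyz_cmPointRingClassData) : tyz_genusPointData :=
  tyz_genusPointData_of_cmPointGaloisData (tyz_cmPointGaloisData_of_cmPointRingClassData h)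

end Literature.NumberTheory.EllipticCurves.TianYuanZhang2017

end
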